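import Mathlib.Algebra.BigOperators.Fin
import Mathlib.Algebra.BigOperators.Pi
import Mathlib.Data.ZMod.Basic
import Mathlib.Data.Matrix.Mul
import Mathlib.LinearAlgebra.Dimension.Constructions
import Mathlib.Tactic.FinCases
import Mathlib.Tactic.Ring

/-!
# Dodecic atlas, type `ℤ/12`: cyclic CM fields of degree 12 (e.g. `ℚ(ζ₁₃)`) — the Hodge lattice of the whole `F`-slice, its five atoms, and the minimality `μ ≥ 5` (kernel census)

COR-CM (cell `pub-hodgecm2`), count-neutral kernel census by the binder seat b17 (gen 39; claim C12-KERNEL, twin of DIC3-KERNEL =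
`Census/DodecicDicyclicSpecies.lean`): the kernel certificate of the `ℤ/12` row of the order-12 table of the cell memos
`HOME/pub-hodgecm2-lit-andre-3/PORTFOLIO-lit-andre-3-g8.md` (μ(ℤ/12) = 5, exact) and `HOME/pub-hodgecm2-b17/dic3/ORDER12-CARRIERS.md`
(b17 gen 38: `H/P ≅ ℤ[i] ⊕ Λ′⁴` over `Λ′ = ℤ[t]/(t⁶+1) = ℤ[i] ×_{𝔽₉} ℤ[ζ₁₂]`, minimal carrier profile `(12,12,12,12,8)`).  Same method and
the same statements as the `Dic₃` twin: the Hodge lattice is a `Submodule ℤ (Pt → ℤ)`, the minimality is a theorem over ALL finite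
generating families, the lattice theorem is an equality of submodules (sequel `Census/DodecicCyclicLattice.lean`).  No named fact,
no geometry, no `sorry`: `decide`, `simp`, `omega` and linear algebra over `ZMod 2` only.  HC_CM is not proved anywhere in this
cell; nothing here is a headline.

DICTIONARY (cited, not formalised; identical to `Census/OcticQuaternionSpecies.lean` / `Census/DecicCyclicSpecies.lean`).
`F` a Galois CM field with group `G = Gal(F/ℚ) = Hom(F, ℚ̄)` and complex conjugation `c ∈ Z(G)`; a CM type of `(G,c)` is `T ⊆ G`
with `T ⊔ cT = G`; isogeny classes of simple CM abelian varieties SPLIT BY `F` ↔ `G`-orbits of CM types under translation, the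
stabiliser `H_T` cuts out the CM field `K = F^{H_T}`, `dim = |G|/2|H_T|`, eigen-labels of `H¹` = cosets `G/H_T` = `Hom(K, ℚ̄)`,
translation = Galois conjugation [cite: Milne1999, Prop. 2.1 and the paragraph after it, p. 54]; a class monomial with exponent
vector `m ≥ 0` is a Hodge class iff all Pohlmann forms vanish [cite: Pohlmann1968, Thm 1]; conjugate pairs = divisor classes.

THIS TYPE.  `G = ℤ/12` (additive, `c = 6`), e.g. `F = ℚ(ζ₁₃)` or any cyclic CM field of degree `12`; CM subfields of `F`: `F`
and the CYCLIC QUARTIC `K₀ = F^⟨4⟩` (`G/⟨4⟩ ≅ ℤ/4`); no imaginary quadratic subfield (the quadratic subfield `F^⟨2⟩` is real).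
`types_census`: `64` CM types = `4` (one orbit with stabiliser `⟨4⟩ = {0,4,8}`: the CM abelian SURFACE `S` with CM by `K₀`)
`+ 5·12` (five primitive types: SIXFOLDS `B₁, …, B₅` with CM by `F`, pairwise non-isogenous).  Labels (`Pt`, 64): `s u`, `u ∈ ℤ/4 = G/⟨4⟩`,
and `q b g`, `g ∈ ℤ/12` (block `B_{b+1}`); `act` = translation (through `eps : ℤ/12 → ℤ/4` on the `S`-labels); `phi` = the total
type (`labels_census`).  The slice is the family of all `S^{n₀} × B₁^{n₁} × ⋯ × B₅^{n₅}`.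
NUMBERS (exact oracle `dic3k/c12model.py`, = lit-andre-3 g8 and b17 g38 `dic3/gmodel.py`): Pohlmann forms of rank `6`, Hodge
lattice `H` of rank `58`, `32` conjugate pairs (`P`), `M = H/P ≅ ℤ²⁶`; no Hodge monomial outside `P` on any carrier of dimension
`≤ 5` or on any power `Sⁿ`, `B_bⁿ`; atoms first appear in dimension `8` (`S × B_b`).

NEIGHBOURS (cited by name, not imported).  `CorCM/CyclotomicRankCensusThirteen.lean` (b04): all `60` primitive CM types of `ℚ(ζ₁₃)`
are nondegenerate, so HC holds UNCONDITIONALLY on every power `B_bⁿ` of every simple CM sixfold with CM by `ℚ(ζ₁₃)` — the diagonal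
of the slice (consistent with the oracle: no atom on any power); `Census/DuodecicFaceSquaresCyclic.lean` (b30): the `1920` rank-four
faces of this Galois type, `20` `Aut`-orbits of type squares, face characters generated by `5` square orbits.  The present file is
about ALL Hodge classes on ALL products `S^{n₀} × ∏ B_b^{n_b}`: the atoms live on the mixed products `B_b × B_{b'}` and `S × B_b`.

KERNEL, THIS FILE.  `types_census`, `labels_census`, `sanity` · `hodgeLattice` (`Submodule ℤ`), `mem_hodgeLattice` · `pairs`
(`P`), `atoms` (`A = Σ_{k<5} ℤ[G]·atom_k`), `atom_census` (Künneth types, carriers `(12,12,12,12,8)`, orbit sizes `12,12,12,12,4`) ·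
`pairs_le`, `atoms_le` · `parity` (five `B`-block parities `ℤ^{64} → 𝔽₂⁵`, `ℤ`-linear, translation invariant, zero on pairs,
ONTO on `H`) · **`five_le_card_of_generates`**: every finite family `S ⊂ ℤ^{64}` with `H ≤ P + Σ_{t ∈ S} ℤ[G]·t` has `|S| ≥ 5`.
KERNEL, SEQUEL `Census/DodecicCyclicLattice.lean`: **`lattice_theorem : hodgeLattice = pairs ⊔ atoms`**, hence `μ(ℤ/12) = 5`.

THE FIVE ATOMS (`orbitRep`, = the first certified minimal family of ORDER12-CARRIERS §5, profile `(12,12,12,12,8)`, exhaustive):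
`R₀` on `B₄ × B₅` (Künneth `(3,1)`), `R₁` on `B₃ × B₄` (`(1,3)`), `R₂` on `B₂ × B₄` (`(1,3)`) — codimension `2` on `12`-folds —,
`R₃` on `B₁ × B₄` (`(5,1)`, codimension `3`), `R₄` on the `8`-fold `S × B₄` (`(1,3) ⊂ H¹(S) ⊗ H³(B₄)`, codimension `2`: the
graph of a morphism of `ℚ`-Hodge structures `H¹(S)(−1) → N ⊂ H³(B₄)` onto a level-one piece).  Every minimal family of the row
contains an atom on a carrier through `S` (ORDER12-CARRIERS §2).

THEOREM (informal; complete given the operations (O1)–(O4) of `Census/DihedralFourCoreLattice.lean`).  Let `Z` be ANY abelian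
variety isogenous to a product of powers of `S, B₁, …, B₅` (for `F = ℚ(ζ₁₃)`: any abelian variety with complex multiplication
through `ℚ(ζ₁₃)` all of whose simple factors have CM field inside `ℚ(ζ₁₃)`).  If for each `k < 5` ONE algebraic class on the
carrier of `R_k` (four explicit CM `12`-folds `B_b × B₄` and the CM `8`-fold `S × B₄`) has a non-zero component on the eigen-line
of `R_k`, then every Hodge class on `Z` is algebraic; no family of fewer than five Galois orbits of Hodge monomials suffices
(`five_le_card_of_generates`).  `F` has no imaginary quadratic subfield, so none of the atoms is a Weil class in the classical
sense (the "Markman column" of the order-12 rows is lit-andre-3's ask A6-R24, not treated here); which of the five statements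
are already known for `ℚ(ζ₁₃)` through Fermat Jacobians (Shioda, Aoki; lit-andre-3's `Census/FermatTypesCyclotomic*.lean`) is NOT
examined here.  Open in print as far as the seat knows.

## References
* [Pohlmann1968] H. Pohlmann, Algebraic cycles on abelian varieties of complex multiplication type, Ann. of Math. 88 (1968), Thm 1.
* [Milne1999] J. S. Milne, Lefschetz motives and the Tate conjecture, Compositio Math. 117 (1999), Prop. 2.1, p. 54.

## Provenance
Exact oracles (seat folder `work/dic3k/`, copies in `HOME/pub-hodgecm2-b17/dic3k/`): `c12model.py` (the slice model, cross-check
with b17 g38 `dic3/gmodel.py` and the family `gexhaust_C12_k5_le12.json[0]`), `rowcert.py` (saturation of the form lattice, the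
exceptional set `E`, the basis `hb`, syzygy-reduced combinations, parity witnesses), `gen_lean_c12.py` (this file and the sequel
are generated verbatim from `data_c12model.json`).
-/

namespace Summit.HodgeConjecture.CorCM.Census.DodecicCyclicSpecies

open Finset

/-! ## The group `ℤ/12`, its CM types and the simple factors -/

/-- The CM types of `(ℤ/12, 6)` as subsets `T ⊆ ℤ/12`: for every `g` exactly one of `g`, `6 + g` lies in `T`. [folklore] -/
def cmTypes : Finset (Finset (ZMod 12)) := univ.powerset.filter fun T => ∀ g : ZMod 12, g ∈ T ↔ 6 + g ∉ T

/-- The CM types of the simple factors (one representative per factor): index `0` is the type of the SURFACE `S` (induced from the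
cyclic quartic `K₀ = F^⟨4⟩`), indices `1, …, 5` the five primitive types (the SIXFOLDS `B₁, …, B₅`). [folklore] -/
def blockType : Fin 6 → Finset (ZMod 12) :=
  ![{0, 1, 4, 5, 8, 9},
    {0, 1, 2, 3, 10, 11},
    {0, 1, 3, 8, 10, 11},
    {0, 1, 2, 5, 9, 10},
    {0, 1, 3, 5, 8, 10},
    {0, 1, 5, 8, 9, 10}]

set_option maxRecDepth 20000 in
/-- **Types census.**  `(ℤ/12, 6)` has exactly `64` CM types; they are exactly the translates `T + g` of the six block types; the
stabilisers are `⟨4⟩ = {0, 4, 8}` for the surface type and trivial for the five primitive types; orbit sizes `4` and `12, …, 12`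
(`4 + 5·12 = 64`: the six simple factors are pairwise non-isogenous and exhaust the simple CM abelian varieties split by `F`;
`dim S = 2`, `dim B_b = 6`). [folklore] -/
theorem types_census : cmTypes.card = 64 ∧
    cmTypes = (univ ×ˢ (univ : Finset (Fin 6))).image (fun p => (blockType p.2).image (fun t => t + p.1)) ∧
    (univ.filter fun g : ZMod 12 => (blockType 0).image (fun t => t + g) = blockType 0) = {0, 4, 8} ∧
    (∀ b : Fin 5, (univ.filter fun g : ZMod 12 => (blockType b.succ).image (fun t => t + g) = blockType b.succ) = {0}) ∧
    (univ.image fun g : ZMod 12 => (blockType 0).image (fun t => t + g)).card = 4 ∧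
    (∀ b : Fin 5, (univ.image fun g : ZMod 12 => (blockType b.succ).image (fun t => t + g)).card = 12) := by
  refine ⟨by decide +kernel, by decide +kernel, by decide +kernel, by decide +kernel, by decide +kernel, by decide +kernel⟩

/-! ## Labels, the Galois action, the total type -/

/-- Labels of the CM eigenvectors: `s u` (`u ∈ ℤ/4 ≅ G/⟨4⟩ = Hom(K₀, ℚ̄)`, the surface) and `q b g` (`g ∈ ℤ/12 = Hom(F, ℚ̄)`, the
sixfold `B_{b+1}`); `64 = 4 + 5·12` labels. [folklore] -/
abbrev Pt := ZMod 4 ⊕ (Fin 5 × ZMod 12)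

/-- `s u`: the eigen-label `u ∈ ℤ/4` of the surface `S`. [folklore] -/
abbrev s (u : ZMod 4) : Pt := Sum.inl u

/-- `q b g`: the eigen-label `g ∈ ℤ/12` of the sixfold `B_{b+1}`. [folklore] -/
abbrev q (b : Fin 5) (g : ZMod 12) : Pt := Sum.inr (b, g)

/-- The quotient map `ℤ/12 → ℤ/4 = G/⟨4⟩` (reduction mod `4`; kernel `{0, 4, 8}`, see `labels_census`): the restriction of the
embedding `g` to `K₀`. [folklore] -/
def eps (g : ZMod 12) : ZMod 4 := (g.val : ZMod 4)

/-- `G = ℤ/12` acts on the labels by translation (Galois conjugation of eigenvectors / of coefficients). [folklore] -/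
def act (g : ZMod 12) : Pt → Pt
  | Sum.inl u => Sum.inl (eps g + u)
  | Sum.inr (b, h) => Sum.inr (b, g + h)

/-- The total CM type `Φ` (labels of Hodge type `(1,0)`), block by block (`labels_census`). [folklore] -/
def phi : Finset Pt := {s 0, s 1, q 0 0, q 0 1, q 0 2, q 0 3, q 0 10, q 0 11, q 1 0, q 1 1, q 1 3, q 1 8, q 1 10, q 1 11, q 2 0, q 2 1,
  q 2 2, q 2 5, q 2 9, q 2 10, q 3 0, q 3 1, q 3 3, q 3 5, q 3 8, q 3 10, q 4 0, q 4 1, q 4 5, q 4 8, q 4 9, q 4 10}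

/-- `Φ` is a CM type for `c = 6`, and `act` is an action (closed sanity check). [folklore] -/
theorem sanity : (∀ x : Pt, x ∈ phi ↔ act 6 x ∉ phi) ∧ (∀ g h : ZMod 12, ∀ x : Pt, act (g + h) x = act g (act h x)) ∧
    (∀ x : Pt, act 0 x = x) := by
  refine ⟨by decide, by decide, by decide⟩

/-- **Labels census**: `eps` is a homomorphism onto `ℤ/4` with kernel `⟨4⟩`, and `Φ` is the total type induced by the block
types: `s (eps g) ∈ Φ ↔ g ∈ blockType 0`, `q b g ∈ Φ ↔ g ∈ blockType (b+1)`. [folklore] -/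
theorem labels_census : (∀ g h : ZMod 12, eps (g + h) = eps g + eps h) ∧
    (univ.filter fun g : ZMod 12 => eps g = 0) = {0, 4, 8} ∧
    (∀ g : ZMod 12, s (eps g) ∈ phi ↔ g ∈ blockType 0) ∧ (∀ b : Fin 5, ∀ g : ZMod 12, q b g ∈ phi ↔ g ∈ blockType b.succ) := by
  refine ⟨by decide, by decide, by decide, by decide⟩

/-! ## Pohlmann's Hodge forms and the Hodge lattice -/

/-- Pohlmann's Hodge functional of `g ∈ ℤ/12` on integer exponent vectors: `Σ_x (2[g·x ∈ Φ] − 1) m_x`. [cite: Pohlmann1968, Thm 1] -/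
def hodgeForm (g : ZMod 12) (m : Pt → ℤ) : ℤ := ∑ x : Pt, (if act g x ∈ phi then m x else -m x)

/-- Block types as a Boolean table (labels `q b g`): entry `(b, g)` = `[g ∈ blockType (b+1)]` (kernel-fast). [folklore] -/
def tB : Fin 5 → Fin 12 → Bool :=
  ![![true, true, true, true, false, false, false, false, false, false, true, true],
    ![true, true, false, true, false, false, false, false, true, false, true, true],
    ![true, true, true, false, false, true, false, false, false, true, true, false],
    ![true, true, false, true, false, true, false, false, true, false, true, false],
    ![true, true, false, false, false, true, false, false, true, true, true, false]]

/-- Boolean membership in `Φ` (kernel-fast twin of `· ∈ phi`, see `inPhi_iff`). [folklore] -/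
def inPhi : Pt → Bool
  | Sum.inl u => decide (u = 0 ∨ u = 1)
  | Sum.inr (b, g) => tB b g

/-- `inPhi` decides membership in `Φ`. [folklore] -/
theorem inPhi_iff : ∀ x : Pt, inPhi x = true ↔ x ∈ phi := by decide

/-- The coefficient vector `(2[g·x ∈ Φ] − 1)_x ∈ {±1}^{64}` of Pohlmann's form `hodgeForm g`. [cite: Pohlmann1968, Thm 1] -/
def hodgeVec (g : ZMod 12) (x : Pt) : ℤ := if inPhi (act g x) then 1 else -1

/-- `hodgeVec` in terms of `Φ`. [folklore] -/
theorem hodgeVec_apply (g : ZMod 12) (x : Pt) : hodgeVec g x = if act g x ∈ phi then 1 else -1 := by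
  unfold hodgeVec
  by_cases h : act g x ∈ phi
  · simp [h, (inPhi_iff (act g x)).mpr h]
  · have h' : inPhi (act g x) ≠ true := fun h'' => h ((inPhi_iff _).mp h'')
    simp [h, h']

/-- Pohlmann's form is the dot product with its coefficient vector. [folklore] -/
theorem hodgeForm_eq (g : ZMod 12) (m : Pt → ℤ) : hodgeForm g m = hodgeVec g ⬝ᵥ m := by
  unfold hodgeForm dotProduct
  refine Finset.sum_congr rfl fun x _ => ?_
  rw [hodgeVec_apply]
  by_cases hx : act g x ∈ phi <;> simp [hx]

/-- **The Hodge lattice** `H ⊂ ℤ^{64}` of the whole `F`-slice (rank `58` by the oracle). [cite: Pohlmann1968, Thm 1] -/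
def hodgeLattice : Submodule ℤ (Pt → ℤ) where
  carrier := {m | ∀ g : ZMod 12, hodgeVec g ⬝ᵥ m = 0}
  zero_mem' := by intro g; simp
  add_mem' := by
    intro m m' hm hm' g
    rw [dotProduct_add, hm g, hm' g, add_zero]
  smul_mem' := by
    intro c m hm g
    rw [dotProduct_smul, hm g, smul_zero]

/-- Membership in the Hodge lattice = vanishing of all Pohlmann forms. [folklore] -/
theorem mem_hodgeLattice (m : Pt → ℤ) : m ∈ hodgeLattice ↔ ∀ g : ZMod 12, hodgeForm g m = 0 := by
  simp only [hodgeForm_eq]; rfl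

/-- The conjugate pair through a label (a divisor-class monomial `e_x ∧ e_{cx}`). [folklore] -/
def pairVec (x : Pt) (y : Pt) : ℤ := if y = x ∨ y = act 6 x then 1 else 0

/-- The divisor sublattice `P = ℤ⟨32 conjugate pairs⟩`. [folklore] -/
def pairs : Submodule ℤ (Pt → ℤ) := Submodule.span ℤ (Set.range pairVec)

/-- Galois translate of an exponent vector: `(g·v)(y) = v(y − g)`. [folklore] -/
def transl (g : ZMod 12) (v : Pt → ℤ) (y : Pt) : ℤ := v (act (-g) y)

/-- Representatives of the FIVE atom orbits (ORDER12-CARRIERS §5, profile `(12,12,12,12,8)`): `R₀` on `B₄ × B₅` (Künneth `(3,1)`),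
`R₁` on `B₃ × B₄` (`(1,3)`), `R₂` on `B₂ × B₄` (`(1,3)`), `R₃` on `B₁ × B₄` (`(5,1)`), `R₄` on `S × B₄` (`(1,3)`); orbit sizes `12, 12, 12, 12, 4`
(`R₄` is fixed by `⟨4⟩`). [folklore] -/
def orbitRep : Fin 5 → Finset Pt :=
  ![{q 3 5, q 3 8, q 3 9, q 4 11},
    {q 2 2, q 3 7, q 3 8, q 3 11},
    {q 1 3, q 3 9, q 3 10, q 3 11},
    {q 0 0, q 0 3, q 0 5, q 0 7, q 0 10, q 3 11},
    {s 3, q 3 1, q 3 5, q 3 9}]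

/-- The atom monomials as exponent vectors. [folklore] -/
def atomVec (k : Fin 5) (y : Pt) : ℤ := if y ∈ orbitRep k then 1 else 0

/-- The atom sublattice `A = Σ_{k<5} ℤ[G]·atom_k`. [folklore] -/
def atoms : Submodule ℤ (Pt → ℤ) := Submodule.span ℤ (Set.range fun p : ZMod 12 × Fin 5 => transl p.1 (atomVec p.2))

/-- The block of a label: `0` for the surface, `b+1` for `B_{b+1}`. [folklore] -/
def blockOf : Pt → Fin 6
  | Sum.inl _ => 0
  | Sum.inr (b, _) => b.succ

/-- **Atom census**: Künneth types (labels per block `S, B₁, …, B₅`; carriers of dimensions `12, 12, 12, 12, 8`, the minimal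
profile of a five-orbit generating family by the exhaustive oracle ORDER12-CARRIERS, not re-decided here) and orbit sizes. [folklore] -/
theorem atom_census :
    (∀ k : Fin 5, (fun j : Fin 6 => ((orbitRep k).filter fun x => blockOf x = j).card) = (![![0, 0, 0, 0, 3, 1], ![0, 0, 0, 1, 3, 0], ![0, 0, 1, 0, 3, 0], ![0, 5, 0, 0, 1, 0], ![1, 0, 0, 0, 3, 0]] : Fin 5 → Fin 6 → ℕ) k) ∧
    (∀ k : Fin 5, (univ.image fun g : ZMod 12 => (orbitRep k).image (act g)).card = (![12, 12, 12, 12, 4] : Fin 5 → ℕ) k) := by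
  refine ⟨by decide, by decide⟩

set_option maxRecDepth 20000 in
/-- Every conjugate pair is a Hodge vector. [folklore] -/
theorem pairVec_hodge : ∀ x : Pt, ∀ g : ZMod 12, hodgeVec g ⬝ᵥ pairVec x = 0 := by
  decide +kernel

set_option maxRecDepth 20000 in
/-- Every translate of every atom is a Hodge vector. [folklore] -/
theorem atom_hodge : ∀ h g : ZMod 12, ∀ k : Fin 5, hodgeVec g ⬝ᵥ transl h (atomVec k) = 0 := by
  decide +kernel

/-- `P ≤ H`. [folklore] -/
theorem pairs_le : pairs ≤ hodgeLattice :=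
  Submodule.span_le.mpr (by rintro _ ⟨x, rfl⟩ g; exact pairVec_hodge x g)

/-- `A ≤ H`. [folklore] -/
theorem atoms_le : atoms ≤ hodgeLattice :=
  Submodule.span_le.mpr (by rintro _ ⟨p, rfl⟩ g; exact atom_hodge p.1 g p.2)

/-- Atoms are in `A`. [folklore] -/
theorem atomVec_mem (k : Fin 5) : atomVec k ∈ atoms := by
  have h : transl 0 (atomVec k) = atomVec k := by
    funext y; simp only [transl, neg_zero, sanity.2.2 y]
  exact h ▸ Submodule.subset_span ⟨(0, k), rfl⟩

/-! ## Minimality: no four Galois orbits generate (`μ(ℤ/12) ≥ 5`) -/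

/-- The five `B`-block parities `m ↦ (Σ_g m(q b g) mod 2)_b`, a `ℤ`-linear map `ℤ^{64} → 𝔽₂⁵`. [folklore] -/
def parity : (Pt → ℤ) →ₗ[ℤ] (Fin 5 → ZMod 2) where
  toFun m := fun b => ∑ g : ZMod 12, ((m (q b g) : ℤ) : ZMod 2)
  map_add' m m' := by
    funext b
    simp only [Pi.add_apply, Int.cast_add, Finset.sum_add_distrib]
  map_smul' c m := by
    funext b
    simp only [Pi.smul_apply, smul_eq_mul, Int.cast_mul, RingHom.id_apply, ← Finset.mul_sum, zsmul_eq_mul]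

/-- The parities vanish on conjugate pairs. [folklore] -/
theorem parity_pairVec : ∀ x : Pt, parity (pairVec x) = 0 := by
  decide

/-- The parities are translation invariant. [folklore] -/
theorem parity_transl (g : ZMod 12) (v : Pt → ℤ) : parity (transl g v) = parity v := by
  funext b
  show ∑ h : ZMod 12, ((v (act (-g) (q b h)) : ℤ) : ZMod 2) = ∑ h : ZMod 12, ((v (q b h) : ℤ) : ZMod 2)
  exact Fintype.sum_equiv (Equiv.addLeft (-g)) _ _ (fun h => rfl)

/-- Hodge vectors whose parity vectors are the five unit vectors (sums of atoms). [folklore] -/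
def unitWitness : Fin 5 → (Pt → ℤ) := ![atomVec 3 + atomVec 4, atomVec 2 + atomVec 4, atomVec 1 + atomVec 4, atomVec 4, atomVec 0 + atomVec 4]

/-- The witnesses realise the unit vectors of `𝔽₂⁵`: `parity` maps `H` onto `𝔽₂⁵`. [folklore] -/
theorem parity_unitWitness : ∀ b : Fin 5, parity (unitWitness b) = Pi.single b 1 := by
  decide

/-- The witnesses are Hodge vectors. [folklore] -/
theorem unitWitness_mem (b : Fin 5) : unitWitness b ∈ hodgeLattice := by
  have hA : ∀ k, atomVec k ∈ hodgeLattice := fun k => atoms_le (atomVec_mem k)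
  fin_cases b <;> simp only [unitWitness] <;>
    repeat (first | exact hA _ | refine Submodule.add_mem _ ?_ ?_)

/-- **MINIMALITY (`μ(ℤ/12) ≥ 5`).**  If the Hodge lattice is generated, together with the divisor classes, by the translates of a finite
family `S` of integer vectors, then `|S| ≥ 5` (the parity map is translation invariant, kills the pairs and maps `H` onto `𝔽₂⁵`). [folklore] -/
theorem five_le_card_of_generates (S : Finset (Pt → ℤ))
    (hS : hodgeLattice ≤ pairs ⊔ Submodule.span ℤ {v | ∃ g : ZMod 12, ∃ t ∈ S, v = transl g t}) : 5 ≤ S.card := by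
  classical
  let T : Finset (Fin 5 → ZMod 2) := S.image parity
  let W : Submodule ℤ (Fin 5 → ZMod 2) := (Submodule.span (ZMod 2) (T : Set (Fin 5 → ZMod 2))).restrictScalars ℤ
  have hle : pairs ⊔ Submodule.span ℤ {v | ∃ g : ZMod 12, ∃ t ∈ S, v = transl g t} ≤ W.comap parity := by
    refine sup_le (Submodule.span_le.mpr ?_) (Submodule.span_le.mpr ?_)
    · rintro _ ⟨x, rfl⟩
      simp [W, parity_pairVec x]
    · rintro _ ⟨g, t, ht, rfl⟩
      have hmem : parity t ∈ (T : Set (Fin 5 → ZMod 2)) := by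
        simpa [T] using Finset.mem_image_of_mem parity ht
      simpa [W, parity_transl] using Submodule.subset_span hmem
  have hunit : ∀ b : Fin 5, (Pi.single b 1 : Fin 5 → ZMod 2) ∈ Submodule.span (ZMod 2) (T : Set (Fin 5 → ZMod 2)) := by
    intro b
    have h := hle (hS (unitWitness_mem b))
    simpa [W, parity_unitWitness b] using h
  have htop : Submodule.span (ZMod 2) (T : Set (Fin 5 → ZMod 2)) = ⊤ := by
    refine Submodule.eq_top_iff'.mpr fun w => ?_
    rw [pi_eq_sum_univ' w]
    exact Submodule.sum_mem _ fun b _ => Submodule.smul_mem _ _ (hunit b)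
  have h1 : Module.finrank (ZMod 2) (Submodule.span (ZMod 2) (T : Set (Fin 5 → ZMod 2))) ≤ T.card :=
    finrank_span_finset_le_card T
  rw [htop, finrank_top, Module.finrank_fin_fun] at h1
  exact h1.trans Finset.card_image_le

end Summit.HodgeConjecture.CorCM.Census.DodecicCyclicSpecies
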